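import Mathlib
import Summits.Ventures.HodgeRepro2.T5HodgeIndexData
import Summits.Ventures.HodgeRepro2.T5HodgeIndexTheorem
import Summits.Ventures.HodgeRepro2.T5HodgeIndexReal
import Summits.Ventures.HodgeRepro2.T5HodgeIndexOneOne
import Summits.Ventures.HodgeRepro2.T5HodgeIndexModel

/-! # T5HodgeIndexModelReal — the real-form statements (Theorem 6.33 for Q on the real classes, BPV IV (2.13)–(2.15)) instantiated on the coframe model at a point: the numbers (3, 3) and (1, 3)

Tier 5, N1 support (route/T5-N1-hodge-p6.md §H1 (V5) / §H3; filer p6; blind lane, Mathlib + own rows only;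
README §8(d): uses an L-value-free non-vanishing device: NO).

PURPOSE. T5HodgeIndexReal and T5HodgeIndexOneOne state Theorem 6.33 for Q on `V_ℝ` (Voisin p0129 l. 17) and BPV's
(2.13)–(2.15) on `H^{1,1}_ℝ` (p0177 ll. 1–9) for an abstract datum; T5HodgeIndexModel shows the coframe model at a
point is a datum (`modelData`).  Here the two are put together: on the model, `V_ℝ` is the space of REAL 2-covectors
(dimension 6), `H^{1,1}_ℝ` the real (1,1)-covectors (dimension 4), and the printed types come out as the numbers
`(3, 3)` for Q on the real 2-covectors (`hodge_index_real_model`) and `(1, 3)` for Q on the real (1,1)-covectors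
(`signature_oneOne_model`) — the pointwise shadow of «type (1, h^{1,1} − 1)» and of «Σ (−1)^a h^{a,b}» with
h^{2,0} = 1, h^{1,1} = 4 at one point.  Also the (2.14)/(2.15) statements on the model: for a real (1,1)-covector h
with `h ∧ h > 0`, every real (1,1)-covector e with `h ∧ e = 0` has `e ∧ e < 0` unless e = 0 (`hodge_index_model_oneOne`),
and the index inequality (`hodge_index_inequality_model`).  These are the §10.5(ii)(c)/(d)-shaped joint witnesses
for the real-form hypotheses of rows 68 / 70; what stays prose: the passage from the point to the surface.
-/

namespace Summit.Ventures.HodgeRepro2.T5HodgeIndexModelReal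

open Module T5HodgeIndexData T5HodgeIndexTheorem T5HodgeIndexReal T5HodgeIndexOneOne T5HodgeIndexModel
  T5HodgeStar

/-- On the model, `Q(x, y)` is row 15's `wedge x y`. -/
theorem modelData_Q (x y : TwoCovector) : modelData.Q x y = wedge x y := rfl

/-- On the model, the conjugation is row 15's `conjC`. -/
theorem modelData_conj (x : TwoCovector) : modelData.conj x = conjC x := rfl

/-- The real classes of the model are the real 2-covectors: `x ∈ V_ℝ ↔ conjC x = x`. -/
theorem mem_realPoints_model_iff (x : TwoCovector) : x ∈ realPoints modelData ↔ conjC x = x := Iff.rfl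

/-- `dim_ℝ V_ℝ = 6` on the model (= dim_ℂ Λ² ⊗ ℂ). -/
theorem finrank_realPoints_model : finrank ℝ (realPoints modelData) = 6 := by
  rw [finrank_realPoints modelData]
  simp [TwoCovector]

/-- `dim_ℝ H^{1,1}_ℝ = 4` on the model. -/
theorem finrank_realV11_model : finrank ℝ (realV11 modelData) = 4 := by
  rw [finrank_realV11 modelData]
  exact finrank_V11

/-- THEOREM 6.33 FOR Q ON THE REAL 2-COVECTORS AT A POINT: `V_ℝ = P_ℝ ⊕ N_ℝ` with Q positive definite on `P_ℝ`,
negative definite on `N_ℝ`, of dimensions `2·1 + 1 = 3` and `4 − 1 = 3` — the pointwise numbers of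
«Σ_{a,b} (−1)^a h^{a,b}» with h^{2,0} = 1, h^{1,1} = 4. -/
theorem hodge_index_real_model :
    ∃ Pr Nr : Submodule ℝ TwoCovector, Pr ≤ realPoints modelData ∧ Nr ≤ realPoints modelData ∧
      Disjoint Pr Nr ∧ Pr ⊔ Nr = realPoints modelData ∧
      (∀ x ∈ Pr, ∀ y ∈ Nr, wedge x y = 0) ∧ (∀ x ∈ Pr, x ≠ 0 → 0 < (wedge x x).re) ∧
      (∀ y ∈ Nr, y ≠ 0 → (wedge y y).re < 0) ∧ finrank ℝ Pr = 3 ∧ finrank ℝ Nr = 3 := by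
  obtain ⟨Pr, Nr, h1, h2, h3, h4, h5, h6, h7, h8, h9⟩ := hodge_index_real modelData
  refine ⟨Pr, Nr, h1, h2, h3, h4, h5, h6, h7, ?_, ?_⟩
  · rw [h8]; show 2 * finrank ℂ V20 + 1 = 3; rw [finrank_V20]
  · rw [h9]; show finrank ℂ V11 - 1 = 3; rw [finrank_V11]

/-- BPV (2.13) AT A POINT: Q on the real (1,1)-covectors has type `(1, 3)`: `H^{1,1}_ℝ = ℝω ⊕ N_ℝ`, Q(ω, ω) = 2 > 0,
Q negative definite on the 3-dimensional `N_ℝ` (the real primitive (1,1)-covectors). -/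
theorem signature_oneOne_model :
    ∃ Pr Nr : Submodule ℝ TwoCovector, Pr ≤ realV11 modelData ∧ Nr ≤ realV11 modelData ∧ Disjoint Pr Nr ∧
      Pr ⊔ Nr = realV11 modelData ∧ (∀ x ∈ Pr, ∀ y ∈ Nr, wedge x y = 0) ∧
      (∀ x ∈ Pr, x ≠ 0 → 0 < (wedge x x).re) ∧ (∀ y ∈ Nr, y ≠ 0 → (wedge y y).re < 0) ∧
      finrank ℝ Pr = 1 ∧ finrank ℝ Nr = 3 := by
  obtain ⟨Pr, Nr, h1, h2, h3, h4, h5, h6, h7, h8, h9⟩ := signature_theorem_oneOne modelData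
  refine ⟨Pr, Nr, h1, h2, h3, h4, h5, h6, h7, h8, ?_⟩
  rw [h9]; show finrank ℂ V11 - 1 = 3; rw [finrank_V11]

/-- The real (1,1)-covectors of the model: `x ∈ H^{1,1}_ℝ ↔ x ∈ V11 ∧ conjC x = x`. -/
theorem mem_realV11_model_iff (x : TwoCovector) : x ∈ realV11 modelData ↔ x ∈ V11 ∧ conjC x = x :=
  mem_realV11_iff modelData x

/-- BPV (2.14)/(2.15) AT A POINT: for real (1,1)-covectors `h, e` with `h ∧ h > 0` and `h ∧ e = 0`: `e ∧ e ≤ 0`, with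
equality iff `e = 0`. -/
theorem hodge_index_model_oneOne {h : TwoCovector} (hh : h ∈ realV11 modelData) (hpos : 0 < (wedge h h).re)
    {e : TwoCovector} (he : e ∈ realV11 modelData) (horth : wedge h e = 0) :
    (wedge e e).re ≤ 0 ∧ ((wedge e e).re = 0 ↔ e = 0) :=
  hodge_index_oneOne modelData hh hpos he horth

/-- The Hodge index inequality at a point: `(h ∧ h)(e ∧ e) ≤ (h ∧ e)²` for real (1,1)-covectors with `h ∧ h > 0`. -/
theorem hodge_index_inequality_model {h : TwoCovector} (hh : h ∈ realV11 modelData) (hpos : 0 < (wedge h h).re)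
    {e : TwoCovector} (he : e ∈ realV11 modelData) : (wedge h h).re * (wedge e e).re ≤ (wedge h e).re ^ 2 :=
  hodge_index_inequality modelData hh hpos he

/-- The Kähler form is a real (1,1)-covector with `ω ∧ ω = 2 > 0` — the `h` of (2.14) exists on the model. -/
theorem kahler_mem_realV11_model : T5KahlerModel.kahler ∈ realV11 modelData ∧
    0 < (wedge T5KahlerModel.kahler T5KahlerModel.kahler).re :=
  ⟨ω_mem_realV11 modelData, by rw [T5KahlerModel.wedge_kahler_kahler]; norm_num⟩

end Summit.Ventures.HodgeRepro2.T5HodgeIndexModelReal
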